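import Literature.Analysis.FluidPDE.ClassicalSuitableRegion
import Literature.Analysis.FluidPDE.NSBoundedSuitableEnergy
import Literature.Analysis.FluidPDE.SuitableWeakExhaustion
import HarnessLib

/-!
# Classical solutions on an open space–time region are suitable weak solutions

Analysis/FluidPDE proofs-layer file (theorems only). Combines
`IsClassicalNSSolutionOnRegion.isDistributionalNSSolutionOn` (`ClassicalSuitableRegion.lean`:
classical solutions on an open region `O`, smooth on `O` only, are distributional solutions on
every open `Q ⊆ O`) with the tree's suitability theorem for bounded distributional solutions
(`isSuitableWeakSolutionOn_of_bounded_of_subset`, `NSBoundedSuitableEnergy.lean`: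
Seregin–Šverák 2009, §2 p. 6 and Remark 3.4; Serrin 1962) on the members of an open exhaustion of
`O` (`exists_open_exhaustion`) and the gluing theorem `IsSuitableWeakSolutionOn.of_exhaustion`
(`SuitableWeakExhaustion.lean`):

* `IsClassicalNSSolutionOnRegion.isSuitableWeakSolutionOn` — a classical solution of the
  unforced Navier–Stokes system with viscosity `ν > 0` on an open region `O ⊆ ℝ × E` is a
  suitable weak solution on `O` in the sense of Caffarelli–Kohn–Nirenberg 1982 / Lin 1998
  (accepted `IsSuitableWeakSolutionOn`; CKN 1982, §2: "if `u` is smooth, (2.5) holds with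
  equality"), and on every open `Q ⊆ O` (`…isSuitableWeakSolutionOn_of_subset`).

This is the standing hypothesis "`(u, p)` is a suitable weak solution of the 3D Navier–Stokes
equations in the parabolic cylinder" of local regularity criteria applied to smooth solutions in
a cylinder (e.g. Pineau–Vicol 2026, proof of Prop. 9.5: "Under the standing assumptions, `(u, p)`
is a suitable weak solution … in the parabolic cylinder `Q_{3/4}`, in the sense of [CKN]. Since we
assumed that `(u, p)` are smooth on `B₁ × (−1, 0)`, only integrability as `t → 0⁻` needs to be
checked"): the local (interior) part is settled here once and for all; the global integrability
up to the parabolic boundary is a separate matter.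

## References

* L. Caffarelli, R. Kohn, L. Nirenberg, Comm. Pure Appl. Math. 35 (1982), §2, (2.1)–(2.5).
  [CaffarelliKohnNirenberg1982]
* G. Seregin, V. Šverák, *On Type I singularities of the local axi-symmetric solutions of the
  Navier–Stokes equations*, Comm. PDE 34 (2009), §2 p. 6, Remark 3.4. [SereginSverak2009]
* B. Pineau, V. Vicol, arXiv:2607.09619 (2026), proof of Prop. 9.5 (p. 33). [PineauVicol2026]
-/

noncomputable section

open Set Function Filter MeasureTheory TopologicalSpace Metric
open _root_.Topology
open scoped ENNReal NNReal

namespace Literature.Analysis.FluidPDE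

variable {E : Type*} [NormedAddCommGroup E] [InnerProductSpace ℝ E] [FiniteDimensional ℝ E]
  [MeasurableSpace E] [BorelSpace E]
variable {O : Set (ℝ × E)} {ν : ℝ} {u : ℝ → E → E} {p : ℝ → E → ℝ}

/-- **Classical solutions on an open region are suitable weak solutions.** A classical solution
`(u, p)` of the unforced Navier–Stokes system with viscosity `ν > 0` on an open space–time region
`O` (`IsClassicalNSSolutionOnRegion O ν 0 u p`) is a suitable weak solution on `O`
(`IsSuitableWeakSolutionOn`; CKN 1982, §2, (2.1)–(2.5), "if `u` is smooth, (2.5) holds with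
equality"): on each member `Uₙ` of an open exhaustion of `O` the pair is a bounded distributional
solution with `p ∈ L^{3/2}(Uₙ)` (continuity on a compact neighbourhood), hence suitable there by
`isSuitableWeakSolutionOn_of_bounded_of_subset`, and suitability glues along the exhaustion.
[cite: CaffarelliKohnNirenberg1982, §2 (2.1)–(2.5)] -/
theorem IsClassicalNSSolutionOnRegion.isSuitableWeakSolutionOn (hO : IsOpen O) (hν : 0 < ν)
    (h : IsClassicalNSSolutionOnRegion O ν 0 u p) :
    IsSuitableWeakSolutionOn ⟨O, hO⟩ ν 0 u p := by
  set Ω : Opens (ℝ × E) := ⟨O, hO⟩ with hΩ_def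
  obtain ⟨U, hmono, hcpt, hcov⟩ := exists_open_exhaustion Ω
  have hle : ∀ n, U n ≤ Ω := fun n => by
    obtain ⟨K, -, hUK, hKΩ⟩ := hcpt n
    exact fun z hz => hKΩ (hUK hz)
  refine IsSuitableWeakSolutionOn.of_exhaustion hle hmono hcov fun n => ?_
  obtain ⟨K, hK, hUK, hKΩ⟩ := hcpt n
  obtain ⟨m, hm⟩ := hcov K hKΩ hK
  obtain ⟨K', hK', hUK', hK'Ω⟩ := hcpt m
  have hK'O : K' ⊆ O := hK'Ω
  -- on `U m`: distributional, finite measure, `u` bounded, `p ∈ L^{3/2}`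
  have hNS : IsDistributionalNSSolutionOn (U m) ν 0 u p :=
    h.isDistributionalNSSolutionOn hO (hUK'.trans hK'O)
  have hvol : volume (U m : Set (ℝ × E)) < ⊤ :=
    lt_of_le_of_lt (measure_mono hUK') hK'.measure_lt_top
  obtain ⟨M, hM⟩ := hK'.exists_bound_of_continuousOn (h.smooth_velocity.continuousOn.mono hK'O)
  have hMae : ∀ᵐ z ∂(volume.restrict (U m : Set (ℝ × E))), ‖u z.1 z.2‖ ≤ M :=
    (ae_restrict_iff' (U m).isOpen.measurableSet).2 (ae_of_all _ fun z hz => hM z (hUK' hz))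
  obtain ⟨Mp, hMp⟩ := hK'.exists_bound_of_continuousOn (h.smooth_pressure.continuousOn.mono hK'O)
  have hle' : ∀ z ∈ (U m : Set (ℝ × E)), ‖p z.1 z.2‖ₑ ^ (3 / 2 : ℝ) ≤ ENNReal.ofReal Mp ^ (3 / 2 : ℝ) := by
    intro z hz
    refine ENNReal.rpow_le_rpow ?_ (by norm_num)
    rw [← ofReal_norm]
    exact ENNReal.ofReal_le_ofReal (hMp z (hUK' hz))
  have hp : ∫⁻ z in (U m : Set (ℝ × E)), ‖p z.1 z.2‖ₑ ^ (3 / 2 : ℝ) < ⊤ :=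
    calc ∫⁻ z in (U m : Set (ℝ × E)), ‖p z.1 z.2‖ₑ ^ (3 / 2 : ℝ)
        ≤ ∫⁻ _ in (U m : Set (ℝ × E)), ENNReal.ofReal Mp ^ (3 / 2 : ℝ) :=
          setLIntegral_mono measurable_const hle'
      _ = ENNReal.ofReal Mp ^ (3 / 2 : ℝ) * volume (U m : Set (ℝ × E)) := setLIntegral_const _ _
      _ < ⊤ := ENNReal.mul_lt_top (ENNReal.rpow_lt_top_of_nonneg
          (by norm_num : (0 : ℝ) ≤ 3 / 2) ENNReal.ofReal_ne_top) hvol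
  exact isSuitableWeakSolutionOn_of_bounded_of_subset hν hNS hvol hMae hp hK hm hUK

/-- The same on every open `Q ⊆ O`: a classical solution on a region `O` (unforced, `ν > 0`;
`O` need not be open here) is a suitable weak solution on `Q`. [cite: CaffarelliKohnNirenberg1982, §2 (2.1)–(2.5)] -/
theorem IsClassicalNSSolutionOnRegion.isSuitableWeakSolutionOn_of_subset (hν : 0 < ν)
    (h : IsClassicalNSSolutionOnRegion O ν 0 u p) {Q : Opens (ℝ × E)}
    (hQ : (Q : Set (ℝ × E)) ⊆ O) : IsSuitableWeakSolutionOn Q ν 0 u p :=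
  (h.mono_of_isOpen hQ Q.isOpen).isSuitableWeakSolutionOn Q.isOpen hν

end Literature.Analysis.FluidPDE

end
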